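import Summits.BirchSwinnertonDyer.BirchSwinnertonDyer.Theorems.ManinLocalTwoThreeKummerDiamondStepTwoPropositionA
import Summits.BirchSwinnertonDyer.BirchSwinnertonDyer.Theorems.ManinLocalTwoThreeKummerDiamondStepTwoDiamondHalf
import Summits.BirchSwinnertonDyer.BirchSwinnertonDyer.Theorems.ManinLocalTwoThreeComplexAutSupply
import HarnessLib

/-!
# es's STEP 2 (D6), VII: the CYCLOTOMIC RELATION on `Aut(ℂ/ℚ)` (`σ(e^{2πi/N}) = e^{2πi d/N}`) satisfies the three `cyc`-hypotheses of
# `StepTwo.propositionA`, and PROPOSITION A SPECIALISED to `Aut(ℂ/ℚ)`, complex conjugation and the diamond half-character of an `X₀(N)`-datum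
(route `ManinLocalTwoThree`, crux C2 `ManinOddAtFour` stmt-BirchSwinnertonDyer-22967; cell bsd-f2-manin, prover p2 gen 21; LEAD card `kummer_diamond` node D6 and
its glue to D5 (es g39 `indexFour_kummerDiamondReciprocity`, T-es-75 currency `σ (cexp (2πI/N)) = cexp (2πI·d/N)`); `--supports stmt-BirchSwinnertonDyer-22967`)

* `exists_inv_pair_of_algEquiv` — every `σ : ℂ ≃ₐ[ℚ] ℂ` has `d, d′ ∈ ℤ`, `dd′ ≡ 1 (mod N)`, with `σ(e^{2πi/N}) = e^{2πi d/N}` (`σ` permutes the primitive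
  `N`-th roots of unity);
* `exists_algEquiv_exp_of_isCoprime` — every `d` coprime to `N` occurs (LEAD p760902 `ComplexAut.exists_complex_algEquiv_exp_pow`, via AUT-EXT);
* `conj_exp_two_pi_I_div` — complex conjugation (`Complex.conjAe.restrictScalars ℚ`) has `d = −1`;
* **`propositionA_complex`** — `propositionA` with `G = (ℂ ≃ₐ[ℚ] ℂ)`, the cyclotomic relation and complex conjugation, and `w = w₀` the diamond
  half-character `γ ↦ π₀(c₀·{∞,γ∞}_f/2)` of a LATTICE-OPTIMAL `X₀(N)`-datum in the index-`4` world (part VI): the ONLY remaining hypotheses are the Kummer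
  subgroup `𝒱` (finite, `|𝒱| ≤ 4`), its THEOREM-K classes for every coprime splitting (es g39's binders verbatim) and one odd class.
UNCONDITIONAL; nothing about E-es-185, C2, Manin's conjecture or BSD is proved.  No definitions, no sorry.
[cite: Stevens1982, §1.3 Thm. 1.3.1] [cite: Stevens1989, §2] [cite: Lang2002, Ch. VIII §1]
-/

set_option autoImplicit false
-- lint-debt: the directory name repeats the summit name (sibling precedent `ManinLocalTwoThreeKummerDiamondStepTwoPropositionA.lean`)
set_option linter.dupNamespace false

noncomputable section

open scoped MatrixGroups
open CongruenceSubgroup WeierstrassCurve Literature.NumberTheory.EllipticCurves Literature.NumberTheory.EllipticCurves.ModularForms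

namespace Summit.BirchSwinnertonDyer.BirchSwinnertonDyer.Theorems.ManinLocalTwoThree.StepTwo

variable {N : ℕ} [NeZero N]

/-! ## §1 The cyclotomic relation on `Aut(ℂ/ℚ)` -/

omit [NeZero N] in
/-- `(e^{2πi/N})^i = e^{2πi·i/N}` for `i ∈ ℕ`, in the integer-cast currency. [folklore] -/
theorem exp_two_pi_I_div_pow_natCast (i : ℕ) :
    Complex.exp (2 * Real.pi * Complex.I / N) ^ i = Complex.exp (2 * Real.pi * Complex.I * ((i : ℤ) : ℂ) / N) := by
  rw [← Complex.exp_nat_mul]; congr 1; push_cast; ring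

/-- `e^{2πi d/N}` only depends on `d mod N`. [folklore] -/
theorem exp_two_pi_I_mul_div_eq_of_cast_eq {d e : ℤ} (h : (d : ZMod N) = (e : ZMod N)) :
    Complex.exp (2 * Real.pi * Complex.I * (d : ℂ) / N) = Complex.exp (2 * Real.pi * Complex.I * (e : ℂ) / N) := by
  obtain ⟨k, hk⟩ := (ZMod.intCast_eq_intCast_iff_dvd_sub d e N).mp h
  have hN : (N : ℂ) ≠ 0 := by exact_mod_cast NeZero.ne N
  have he : (e : ℂ) = d + N * k := by
    have : (e : ℤ) = d + N * k := by linear_combination hk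
    rw [this]; push_cast; ring
  rw [he, show 2 * Real.pi * Complex.I * ((d : ℂ) + N * k) / N = 2 * Real.pi * Complex.I * d / N + k * (2 * Real.pi * Complex.I) by
    field_simp, Complex.exp_add, Complex.exp_int_mul_two_pi_mul_I, mul_one]

/-- **Every `σ ∈ Aut_ℚ(ℂ)` acts on `ζ_N = e^{2πi/N}` by an invertible exponent**: `σ(ζ_N) = e^{2πi d/N}` with `dd′ ≡ 1 (mod N)`. [folklore] -/
theorem exists_inv_pair_of_algEquiv (σ : ℂ ≃ₐ[ℚ] ℂ) :
    ∃ d d' : ℤ, ((d * d' : ℤ) : ZMod N) = 1 ∧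
      σ (Complex.exp (2 * Real.pi * Complex.I / N)) = Complex.exp (2 * Real.pi * Complex.I * d / N) := by
  have hN : N ≠ 0 := NeZero.ne N
  have hζ : IsPrimitiveRoot (Complex.exp (2 * Real.pi * Complex.I / N)) N := Complex.isPrimitiveRoot_exp N hN
  have hσζ : IsPrimitiveRoot (σ (Complex.exp (2 * Real.pi * Complex.I / N))) N := hζ.map_of_injective σ.injective
  obtain ⟨i, -, hi⟩ := hζ.eq_pow_of_pow_eq_one hσζ.pow_eq_one
  have hcop : i.Coprime N := (hζ.pow_iff_coprime (Nat.pos_of_ne_zero hN) i).mp (by rw [hi]; exact hσζ)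
  obtain ⟨u, v, huv⟩ := Nat.isCoprime_iff_coprime.mpr hcop
  refine ⟨i, u, ?_, ?_⟩
  · have e : (i : ℤ) * u = 1 + (-v) * N := by linear_combination huv
    rw [e]; push_cast; simp
  · rw [← hi, exp_two_pi_I_div_pow_natCast]

/-- **Every exponent coprime to `N` occurs** (automorphism extension from `ℚ(ζ_N)`, LEAD p760902). [cite: Lang2002, Ch. VIII §1 and Ch. V §2 Thm. 2.8] -/
theorem exists_algEquiv_exp_of_isCoprime {d : ℤ} (hd : IsCoprime d (N : ℤ)) :
    ∃ σ : ℂ ≃ₐ[ℚ] ℂ, σ (Complex.exp (2 * Real.pi * Complex.I / N)) = Complex.exp (2 * Real.pi * Complex.I * d / N) := by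
  have hN : N ≠ 0 := NeZero.ne N
  -- reduce `d` mod `N` to a natural number
  set n : ℕ := (d % N).toNat with hn
  have hn0 : (0 : ℤ) ≤ d % N := Int.emod_nonneg d (by exact_mod_cast hN)
  have hnd : ((n : ℤ) : ZMod N) = (d : ZMod N) := by
    rw [hn, Int.toNat_of_nonneg hn0, ZMod.intCast_eq_intCast_iff_dvd_sub]
    exact ⟨d / N, by linear_combination (-1 : ℤ) * Int.emod_add_ediv_mul d N⟩
  have hcop : n.Coprime N := by
    have h1 : IsCoprime (n : ℤ) (N : ℤ) := by
      obtain ⟨u, v, huv⟩ := hd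
      obtain ⟨k, hk⟩ := (ZMod.intCast_eq_intCast_iff_dvd_sub n d N).mp hnd
      exact ⟨u, v + u * k, by linear_combination huv - u * hk⟩
    exact Nat.isCoprime_iff_coprime.mp h1
  obtain ⟨σ, hσ⟩ := ComplexAut.exists_complex_algEquiv_exp_pow N hN n hcop
  exact ⟨σ, by rw [hσ, exp_two_pi_I_div_pow_natCast, exp_two_pi_I_mul_div_eq_of_cast_eq hnd]⟩

omit [NeZero N] in
/-- Complex conjugation, as a `ℚ`-algebra automorphism of `ℂ`, has exponent `−1` on `ζ_N`. [folklore] -/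
theorem conj_exp_two_pi_I_div :
    (Complex.conjAe.restrictScalars ℚ) (Complex.exp (2 * Real.pi * Complex.I / N)) =
      Complex.exp (2 * Real.pi * Complex.I * ((-1 : ℤ) : ℂ) / N) := by
  change (starRingEnd ℂ) (Complex.exp (2 * Real.pi * Complex.I / N)) = _
  rw [← Complex.exp_conj, map_div₀, map_mul, map_mul, Complex.conj_I, Complex.conj_ofReal, map_natCast, map_ofNat]
  congr 1; push_cast; ring

/-! ## §2 PROPOSITION A on `Aut(ℂ/ℚ)` for the diamond half-character of a lattice-optimal `X₀(N)`-datum in the index-`4` world -/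

/-- **PROPOSITION A, complex form** (D6 with D8/D9 and the Galois supply discharged).  For a lattice-optimal `X₀(N)`-datum `D₀` of `W₀` in the index-`4`
world `Λ₁ = 2Λ₀`, write `w₀ γ = π₀(c₀·{∞,γ∞}_f/2)` and `cyc σ d :⟺ σ(e^{2πi/N}) = e^{2πi d/N}`.  If a finite subgroup `𝒱` of functions
`(ℂ ≃ₐ[ℚ] ℂ) → W₀(ℂ)` with `|𝒱| ≤ 4` contains, for every coprime splitting `N = Q·y`, a class with THEOREM K's shape (es g39
`indexFour_kummerDiamondReciprocity`), and a class odd at complex conjugation, then `2⁵ ∣ N` and the STEP-2 structure holds (see `propositionA`).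
Nothing about E-es-185, C2, Manin's conjecture or BSD is proved. [cite: Stevens1989, §2] [cite: Stevens1982, §1.3 Thm. 1.3.1] -/
theorem propositionA_complex {W₀ : WeierstrassCurve ℚ} (D₀ : ModularParametrizationData W₀ N)
    (hopt : ∀ z ∈ D₀.L.lattice, ∃ w ∈ periodLattice D₀.f, z = D₀.c * w)
    (h4 : ∀ z : ℂ, z ∈ periodLatticeGamma1 D₀.f ↔ ∃ w ∈ periodLattice D₀.f, z = 2 * w)
    (𝒱 : AddSubgroup ((ℂ ≃ₐ[ℚ] ℂ) → (W₀.baseChange ℂ).toAffine.Point)) (h𝒱fin : (𝒱 : Set ((ℂ ≃ₐ[ℚ] ℂ) → (W₀.baseChange ℂ).toAffine.Point)).Finite)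
    (h𝒱 : Nat.card 𝒱 ≤ 4)
    (hKum : ∀ Q y : ℕ, Q * y = N → Nat.Coprime Q y → ∃ f ∈ 𝒱, ∀ (σ : ℂ ≃ₐ[ℚ] ℂ) (d d' : ℤ), ((d * d' : ℤ) : ZMod N) = 1 →
      σ (Complex.exp (2 * Real.pi * Complex.I / N)) = Complex.exp (2 * Real.pi * Complex.I * d / N) →
      ∀ γ : Gamma0 N, ((((γ : SL(2, ℤ)) 1 1 : ℤ)) : ZMod Q) = (d' : ZMod Q) → ((((γ : SL(2, ℤ)) 1 1 : ℤ)) : ZMod y) = 1 →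
        f σ = D₀.uniformize ((D₀.c : ℂ) * cuspSymbol D₀.f γ / 2))
    (hodd : ∃ f ∈ 𝒱, f (Complex.conjAe.restrictScalars ℚ) ≠ 0) :
    2 ^ 5 ∣ N ∧
    ∃ (p a b y₂ yp : ℕ) (v : (W₀.baseChange ℂ).toAffine.Point) (h₁ h₂ : (ℂ ≃ₐ[ℚ] ℂ) → (W₀.baseChange ℂ).toAffine.Point),
      p.Prime ∧ p ≠ 2 ∧ p % 4 = 3 ∧ 5 ≤ a ∧ 1 ≤ b ∧ 2 ^ a * y₂ = N ∧ Nat.Coprime (2 ^ a) y₂ ∧ p ^ b * yp = N ∧ Nat.Coprime (p ^ b) yp ∧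
      v ≠ 0 ∧ (∃ γ : Gamma0 N, D₀.uniformize ((D₀.c : ℂ) * cuspSymbol D₀.f γ / 2) = v) ∧ h₁ ∈ 𝒱 ∧ h₂ ∈ 𝒱 ∧ h₁ ≠ h₂ ∧
      h₁ (Complex.conjAe.restrictScalars ℚ) = v ∧ h₂ (Complex.conjAe.restrictScalars ℚ) = v ∧
      (∀ f ∈ 𝒱, f = 0 ∨ f = h₁ ∨ f = h₂ ∨ f = h₁ + h₂) ∧ (∀ f ∈ 𝒱, f (Complex.conjAe.restrictScalars ℚ) ≠ 0 → f = h₁ ∨ f = h₂) ∧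
      (∀ (σ : ℂ ≃ₐ[ℚ] ℂ) (d d' : ℤ), ((d * d' : ℤ) : ZMod N) = 1 →
        σ (Complex.exp (2 * Real.pi * Complex.I / N)) = Complex.exp (2 * Real.pi * Complex.I * d / N) → ∀ γ : Gamma0 N,
        ((((γ : SL(2, ℤ)) 1 1 : ℤ)) : ZMod (2 ^ a)) = (d' : ZMod (2 ^ a)) → ((((γ : SL(2, ℤ)) 1 1 : ℤ)) : ZMod y₂) = 1 →
          h₁ σ = D₀.uniformize ((D₀.c : ℂ) * cuspSymbol D₀.f γ / 2)) ∧
      (∀ (σ : ℂ ≃ₐ[ℚ] ℂ) (d d' : ℤ), ((d * d' : ℤ) : ZMod N) = 1 →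
        σ (Complex.exp (2 * Real.pi * Complex.I / N)) = Complex.exp (2 * Real.pi * Complex.I * d / N) → ∀ γ : Gamma0 N,
        ((((γ : SL(2, ℤ)) 1 1 : ℤ)) : ZMod (p ^ b)) = (d' : ZMod (p ^ b)) → ((((γ : SL(2, ℤ)) 1 1 : ℤ)) : ZMod yp) = 1 →
          h₂ σ = D₀.uniformize ((D₀.c : ℂ) * cuspSymbol D₀.f γ / 2)) ∧
      (∀ (σ : ℂ ≃ₐ[ℚ] ℂ) (d d' : ℤ), ((d * d' : ℤ) : ZMod N) = 1 →
        σ (Complex.exp (2 * Real.pi * Complex.I / N)) = Complex.exp (2 * Real.pi * Complex.I * d / N) → (h₂ σ = 0 ↔ IsSquare ((d : ZMod p)))) ∧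
      (∀ σ : ℂ ≃ₐ[ℚ] ℂ, h₂ σ = 0 ∨ h₂ σ = v) ∧
      (∀ (σ τ : ℂ ≃ₐ[ℚ] ℂ) (d d' e e' : ℤ), ((d * d' : ℤ) : ZMod N) = 1 →
        σ (Complex.exp (2 * Real.pi * Complex.I / N)) = Complex.exp (2 * Real.pi * Complex.I * d / N) → ((e * e' : ℤ) : ZMod N) = 1 →
        τ (Complex.exp (2 * Real.pi * Complex.I / N)) = Complex.exp (2 * Real.pi * Complex.I * e / N) →
        (h₁ σ = h₁ τ ↔ (d : ZMod 8) = (e : ZMod 8))) ∧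
      (∀ γ : Gamma0 N, ∃ σ : ℂ ≃ₐ[ℚ] ℂ, h₁ σ = D₀.uniformize ((D₀.c : ℂ) * cuspSymbol D₀.f γ / 2)) := by
  have hc : (Complex.conjAe.restrictScalars ℚ) (Complex.exp (2 * Real.pi * Complex.I / N)) =
      Complex.exp (2 * Real.pi * Complex.I * ((-1 : ℤ) : ℂ) / N) := conj_exp_two_pi_I_div
  exact propositionA (fun γ : Gamma0 N ↦ D₀.uniformize ((D₀.c : ℂ) * cuspSymbol D₀.f γ / 2))
    (fun (σ : ℂ ≃ₐ[ℚ] ℂ) (d : ℤ) ↦ σ (Complex.exp (2 * Real.pi * Complex.I / N)) = Complex.exp (2 * Real.pi * Complex.I * d / N))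
    (Complex.conjAe.restrictScalars ℚ)
    (uniformize_half_cuspSymbol_mul D₀) (fun γ hγ ↦ uniformize_half_cuspSymbol_eq_zero_of_cast_eq_one D₀ h4 hγ)
    (uniformize_half_cuspSymbol_add_self D₀) (fun γ hγ ↦ uniformize_half_cuspSymbol_eq_zero_of_cast_ceilSqrtLevel D₀ h4 hγ)
    (four_le_ncard_range_uniformize_half_cuspSymbol D₀ hopt) exists_inv_pair_of_algEquiv
    (fun d hd ↦ exists_algEquiv_exp_of_isCoprime hd) hc 𝒱 h𝒱fin h𝒱 hKum hodd

end Summit.BirchSwinnertonDyer.BirchSwinnertonDyer.Theorems.ManinLocalTwoThree.StepTwo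

end
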